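import Summits.Ventures.CertifiedManyBodySolver.Rows.CorrWindowCertKernelChainQuotAdj

/-!
# tier-P instance (S2Rm2u-R13-W3) — letters

Generated by hubbard-algo-p2's untrusted exporter (emit_v0.py + emit_w3.py); every datum below is re-derived / re-checked by the kernel chain
(`stepEQA`, Rows/CorrWindowCertKernelChainQuotAdj.lean) or is inert. HONEST FRAMING (xx1): instance data / kernel replay of a CONTROL/CALIBRATION
certificate (S2′-Rm2-u″ OVERHANG pinned spoke of the La214-E t′-pair {S2′ −357/740, hub′ −3/10}: t′ = −357/740, CORNER objective t′_X = −3/10, eom multipliers PINNED to the hub-Rm2-u′ certificate (EB by name), sdp-1 (R1) C-edition j326976, 4^40-dyadic two-level Gram factors); nothing here is a theorem about the Hubbard model; no summit statement. [cite: Han2020Bootstrap, §3]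
-/

set_option linter.style.longLine false
set_option maxRecDepth 100000
set_option maxHeartbeats 0

namespace Summit.Ventures.CertifiedManyBodySolver
namespace CARPolyWindow.TierP.S2Rm2u
open Summit.Ventures.CertifiedQuantumChemistry Summit.Ventures.CertifiedQuantumChemistry.CARPoly
open Literature.MathematicalPhysics.QuantumLattice Literature.MathematicalPhysics.QuantumLattice.HubbardWave0
open Literature.Probability.LatticeModels
open CARPolyWindow

/-- Window letter `(site index k, spin σ)` of the 729-site box. [folklore] -/
abbrev L (k σ : ℕ) : Orb (Fin 729) := orb (Fin.ofNat 729 k) (Fin.ofNat 2 σ)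

/-- Inner letter `(inner index j, spin σ)` of the 169-site box. [folklore] -/
abbrev Lb (j σ : ℕ) : Orb (Fin 169) := orb (Fin.ofNat 169 j) (Fin.ofNat 2 σ)

/-- Inner letter from its code `e = 2j+σ`. [folklore] -/
def dec (e : ℕ) : Orb (Fin 169) := Lb (e / 2) (e % 2)

/-- zigzag-coded integer: `2m ↦ m`, `2m+1 ↦ -(m+1)` (ℕ literals elaborate fast; nested ℤ list literals do not — farm finding 2026-08-29). [folklore] -/
def zd (k : ℕ) : ℤ := if k % 2 = 0 then ((k / 2 : ℕ) : ℤ) else -(((k / 2 : ℕ) : ℤ) + 1)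

/-- window letter with its dagger flag from the code `c = 4k + 2σ + d` (`d = 1` ⇔ flag `true`). [folklore] -/
def decW (c : ℕ) : Orb (Fin 729) × Bool := (L (c / 4) (c / 2 % 2), c % 2 == 1)

/-- a Gram block row from ℕ codes: integer row (zigzag), the ONE word v_a (letter codes) and its sign (`0` ↦ `+1`, else `-1`). [folklore] -/
def R (zs ls : List ℕ) (s : ℕ) : List ℤ × Terms (Orb (Fin 729)) := (zs.map zd, [(ls.map decW, if s = 0 then 1 else -1)])

/-- a class-table entry (creator codes, annihilator codes) — function-application form of the pair. [folklore] -/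
def P (cs as : List ℕ) : List ℕ × List ℕ := (cs, as)

end CARPolyWindow.TierP.S2Rm2u
end Summit.Ventures.CertifiedManyBodySolver
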